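/-
Copyright (c) 2026 the pub-hodgecm-mathlib formalisation cell (harness21).  Prover seat hodgecm-mathlib-A-p06 (g28) — (U) road brick (b1)∕U1, FILE C (the CM reading), 2026-09-01.
-/
import Literature.NumberTheory.Weil1964.UnitaryArchLocalTopFormHaar     -- FILE B (A-p06 g28): `localTopFormHaar`, `isHaarMeasure_localTopFormHaar`
import HarnessLib

/-!
# The per-place top-form Haar measure `μ^TF_w` on the archimedean factor `archLocal L N H w = U(σ_w H)(ℂ)` of a CM unitary group ((U) road, U1 FILE C)

Topic `NumberTheory/Weil1964`, namespace `Literature.NumberTheory.Weil1964.UnitaryArchLocalTopForm`.  ONE DEFINITION WITH BODY (`archLocalTopFormHaar`) + 2 theorems; no named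
fact, no instance, no notation, no `sorry`.  Cell `pub/hodgecm-mathlib`, crux H413 = `stmt-HodgeConjecture-24833` (supports only); (U) road (LEAD T9-34 (2); owner A-p19 (g24)).
`archLocalTopFormHaar L N H w := localTopFormHaar N (H.map w.1.embedding)` — FILE B's one-place top-form Haar measure read on ★ `archLocal L N H w`, which IS
`unitaryGroupOfForm (starRingEnd ℂ) (H.map w.1.embedding)` (★ `UnitaryGroupArchimedeanPlaces` :99, `rfl`); the `[MeasurableSpace]`∕`[BorelSpace]` binders on `archLocal L N H w`
are carried across that `rfl` by explicit ascription (kept OUT of FILE B, whose `backward.isDefEq.respectTransparency false` — needed there for the submodule topology — blocks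
the unfolding of `archLocal`).  HONEST LABEL: HC_CM is proved only modulo the 2 remaining named inputs (hLiu418 24832, h413 24833) until rung 0 closes; nothing printed is
discharged here.

## References
* J. D. Rogawski, *Automorphic Representations of Unitary Groups in Three Variables*, Ann. of Math. Stud. 123 (1990), §1.7 p. 6. [Rogawski1990]
* I. G. Macdonald, *The volume of a compact Lie group*, Invent. Math. 56 (1980), 93–95. [Macdonald1980]
-/

set_option autoImplicit false

noncomputable section

open MeasureTheory MeasureTheory.Measure NumberField
open scoped Matrix MatrixGroups

namespace Literature.NumberTheory.Weil1964

namespace UnitaryArchLocalTopForm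

open Literature.NumberTheory.Automorphic Literature.NumberTheory.Automorphic.UnitaryGroup

/-! ## The CM reading: the factor `U(σ_w H)(ℂ) = archLocal L N H w` -/

section CM

variable (L : Type) [Field L] (N : ℕ) (H : Matrix (Fin N) (Fin N) L) (w : {w : InfinitePlace L // w.IsComplex}) [MeasurableSpace (GL (Fin N) ℂ)] [BorelSpace (GL (Fin N) ℂ)]

/-- **THE PER-PLACE TOP-FORM HAAR MEASURE `μ^TF_w` ON `U(σ_w H)(ℂ) = archLocal L N H w`** (CENSUS-Jval (b1)): `localTopFormHaar N (H.map w.1.embedding)` — ★ `archLocal L N H w`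
IS `unitaryGroupOfForm (starRingEnd ℂ) (H.map w.1.embedding)` (★ `UnitaryGroupArchimedeanPlaces`, definitional); the σ-algebra is the subtype structure under
`[MeasurableSpace (GL (Fin N) ℂ)] [BorelSpace (GL (Fin N) ℂ)]` (the (U) road's `hU` convention, owner (m1)). [cite: Rogawski1990, §1.7 p. 6] [cite: Macdonald1980, p. 93] -/
def archLocalTopFormHaar : Measure (archLocal L N H w) := localTopFormHaar N (H.map w.1.embedding)

/-- Unfolding to the `(ν(W) ∕ haar(ĉ '' W)) • haar` body (owner (m2): U2∕U3 `rw` here). [cite: Rogawski1990, §1.7 p. 6] -/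
theorem archLocalTopFormHaar_eq :
    archLocalTopFormHaar L N H w =
      (letI : MeasurableSpace (skewC N (H.map w.1.embedding)) := borel _
       haveI : BorelSpace (skewC N (H.map w.1.embedding)) := ⟨rfl⟩
       haveI := locallyCompactSpace_unitaryGroupOfForm_complex (n := Fin N) (H.map w.1.embedding)
       ((cayleyChartMeasureC N (H.map w.1.embedding) (lieStdLebesgueC N (H.map w.1.embedding)) (windowC N (H.map w.1.embedding))
            (cayleyChartC N (H.map w.1.embedding) '' windowC N (H.map w.1.embedding)) /
          Measure.haar (cayleyChartC N (H.map w.1.embedding) '' windowC N (H.map w.1.embedding))) •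
        (Measure.haar : Measure (unitaryGroupOfForm (starRingEnd ℂ) (H.map w.1.embedding))) : Measure (unitaryGroupOfForm (starRingEnd ℂ) (H.map w.1.embedding)))) := rfl

/-- `μ^TF_w` is a Haar measure on `archLocal L N H w` (under non-degeneracy of the trace form on `𝔲(σ_w H)`). [cite: Rogawski1990, §1.7 p. 6] -/
theorem isHaarMeasure_archLocalTopFormHaar (hnd : lieGramDetC N (H.map w.1.embedding) ≠ 0) : (archLocalTopFormHaar L N H w).IsHaarMeasure :=
  isHaarMeasure_localTopFormHaar hnd

end CM

end UnitaryArchLocalTopForm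

end Literature.NumberTheory.Weil1964

end
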